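import Summits.QuantumFields.BalabanUV.T4Continuum.Support.NE7PairCovGradRate40
import Summits.QuantumFields.BalabanUV.T4Continuum.Support.NE7PairCurlSupRateGeneric
import HarnessLib

/-!
# NE7PairCovGradRate40Generic — PORT MAP P3.6b: THE ONE-LEVEL COVARIANT-GRADIENT RATE OF A DECOMPOSED PAIR COORDINATE, TARGET EXPONENT `b ≤ 41`, AT ANY BLOCK SIZE `L ≥ 2` — gen 108's
# `NE7PairCovGradRate40.covGrad_rate_le` (`L = 2`) RE-ISSUED with `M = L^{j+1}`, `θ^{18} = L⁻¹` (so `M⁴θ^{72(j+1)} = 1` for every `L`), the curved C¹ letter's constant absorbing the block-size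
# logarithm (`1 + log M = 1 + (j+1)·log L ≤ (1 + log L)(1 + (j+1))`, `K_G := K_G⁰·(1 + log L)`); the cube-root bootstrap (`NE7CovGradBootstrapAlgebra`) is pure real and unchanged

Cell `pub-balaban`, rung (B)+1 sub-cell t4, lineage `b2b-balaban-t4-ne7-p1`, generation 109 (CRUX PROVER NE7 #1 = OWNER of BINDER row NE7).  Memo
`t4/b2b-balaban-t4-ne7-p1-g109/ROAD-G109.md` §3 (PORT MAP item P3.6b; consumer: the generic (Gᶜ_w) assembly = gen 108's `NE7EnergyGradRateWSU2Log` at block size `L`, PORT MAP P3.6c).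
WHAT ([folklore]; 0 def, 0 sorry).  **`covGrad_rate_le_generic`** — statement of `covGrad_rate_le` TOKEN FOR TOKEN under the recipe.
HONEST FRAMING (page 1): [folklore] lattice kinematics ∕ elementary real analysis over landed kernel theorems (gen 107's curved C¹ letter, gen 22's local-average rate, gen 108's bootstrap
algebra — all generic); nothing of Bałaban's asserted; NE7 NOT proved; spine 0∕9; finite T⁴ rung (B)+1 — NOT infinite volume, NOT mass gap, NOT BetaPertH, NOT Clay (continuum YM on T⁴ ⇐ BetaPertH ∧
nine spine estimates).
-/

set_option autoImplicit false



open scoped BigOperators Matrix Matrix.Norms.L2Operator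
open Finset NormedSpace Set

namespace Summit.QuantumFields.BalabanUV.T4Continuum.NE7PairCovGradRate40Generic

open Literature.MathematicalPhysics.QuantumFieldTheory.Balaban1983to89
open B7Prop1Explicit B7Prop2Explicit
open T4AveragingDeficitWall hiding Site Plane Plaq Bond
open T4AveragingDeficitWallBoundary (periodBox IsPeriodicCfg mem_periodBox)
open T4AveragingDeficitNonAbelian (Ad_sub)
open AveragingDeficitNearIdentity (Ad_add)
open AveragingDeficitTransport (norm_Ad_of_unitary)
open AveragingDeficitPeriodicCounting (IsPeriodicDir)
open AveragingDeficitMultiLevelPrep (LevelSmall tower)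
open AveragingDeficitTorusChart (redN eq_wrap_add periodic_smul_vec)
open AveragingDeficitFermat (boxVec_redN_mem)
open NE3EnergyWeightedShapes (energyNormW energyNormW_nonneg)
open NE3EnergyHessBilin (curlAt_add)
open NE3FramePotBoundW (tower_eq_pow_mul)
open BlockAverageCurrent (curConst curConst_nonneg)
open NE7MeanZeroGaugeSliceW (energyBlockLandauW)
open NE7EtaClosenessHolder (theta18_lt_one)
open NE7CurvedGradLetterUniform (curved_grad_letter)
open NE7PairCurlSupRateGeneric (curl_sup_rate)
open NE7CovGradBootstrapAlgebra (exists_cube_root caseB_bound rate_caseA_le rate_caseB_le rate_normal_le)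
open NE7PairCovGradRate (exists_max_covGrad)

noncomputable section

variable {n : Type*} [Fintype n] [DecidableEq n]

/-! ## The covariant-gradient rate of a decomposed pair coordinate, parametric target exponent -/

set_option maxHeartbeats 800000 in
/-- **THE COVARIANT-GRADIENT RATE OF A DECOMPOSED PAIR COORDINATE AT ONE LEVEL, TARGET EXPONENT `b ≤ 41`** (`NE7PairCovGradRate.covGrad_rate` is `b = 38`). [folklore] -/
theorem covGrad_rate_le_generic [Nonempty n] {L : ℕ} (hL : 2 ≤ L) :
    ∃ KG : ℝ, 0 < KG ∧ ∃ ε₀ : ℝ, 0 < ε₀ ∧ ∀ (b : ℕ), b ≤ 41 → ∀ (N : ℕ) [NeZero N] (j : ℕ) (ε CSε c cN : ℝ), 0 < ε → ε ≤ ε₀ → 0 ≤ CSε → CSε ≤ 1 / 48 → 0 ≤ c → 0 ≤ cN →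
      ∀ (W : Site 4 → Fin 4 → (Matrix n n ℂ)ˣ), IsUnitaryCfg W → IsPeriodicCfg W ((N * L ^ (j + 1) : ℕ) : ℤ) →
      SmallField W (ε / ((L : ℝ) ^ (j + 1)) ^ 2) → LevelSmall 4 L j (ε / ((L : ℝ) ^ (j + 1)) ^ 2) →
      ∀ (X XT XN : Site 4 → Fin 4 → Matrix n n ℂ), IsSkewDir X → IsPeriodicDir X ((N * L ^ (j + 1) : ℕ) : ℤ) → X = XT + XN →
      XT ∈ energyBlockLandauW (d := 4) (n := n) L N (j + 1) W →
      ∀ (α : ℝ), (∀ x μ, ‖X x μ‖ ≤ α) → α * (L : ℝ) ^ (j + 1) ≤ CSε → SmallField (vary W X 1) (ε / ((L : ℝ) ^ (j + 1)) ^ 2) →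
      ∀ (γ : ℝ), 0 < γ → (L : ℝ) ^ (j + 1) * energyNormW L (j + 1) W X (periodBox (d := 4) (N * L ^ (j + 1))) ≤ γ ^ 3 →
      (∀ (y : Site 4) (μ : Fin 4), ‖XN y μ‖ ≤ cN / (L : ℝ) ^ (j + 1) * energyNormW L (j + 1) W X (periodBox (d := 4) (N * L ^ (j + 1))) ^ 2) →
      (∀ (z : Site 4) (μ ν : Fin 4), μ ≠ ν →
        ‖curlAt W XN z μ ν‖ ≤ cN / ((L : ℝ) ^ (j + 1)) ^ 2 * energyNormW L (j + 1) W X (periodBox (d := 4) (N * L ^ (j + 1))) ^ 2) →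
      (∀ (p : Site 4) (lam μ ν : Fin 4), μ ≠ ν →
        ‖Ad (W p lam) ((hol W (p + e lam) (plaqWord μ ν) : (Matrix n n ℂ)ˣ) : Matrix n n ℂ) - ((hol W p (plaqWord μ ν) : (Matrix n n ℂ)ˣ) : Matrix n n ℂ)‖
          ≤ 2 * (c + curConst 4 L * ε ^ 2) / ((L : ℝ) ^ (j + 1)) ^ 3) →
      (∀ (p : Site 4) (lam μ ν : Fin 4), μ ≠ ν →
        ‖Ad (vary W X 1 p lam) ((hol (vary W X 1) (p + e lam) (plaqWord μ ν) : (Matrix n n ℂ)ˣ) : Matrix n n ℂ)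
            - ((hol (vary W X 1) p (plaqWord μ ν) : (Matrix n n ℂ)ˣ) : Matrix n n ℂ)‖ ≤ 2 * c / ((L : ℝ) ^ (j + 1)) ^ 3) →
      ∀ (θ : ℝ), 0 < θ → θ ^ 18 = ((L : ℝ))⁻¹ →
      ∀ (κ : Fin 4) (x : Site 4) (μ : Fin 4),
        ‖Ad (W (x + e κ) μ) (X (x + e μ) κ) - X x κ‖
          ≤ (32 * KG * (max γ (max 1 (10 * c + 6 * curConst 4 L * ε ^ 2 + 8 * CSε * ε + 4096 * CSε ^ 2 * ε + 1330 * CSε ^ 3))) ^ 2 * γ * (1 - θ)⁻¹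
              + 2 ^ 27 * CSε ^ 2 * KG ^ 3 * γ ^ 3 * ((1 - θ)⁻¹) ^ 3
              + 2 * (KG * cN * γ ^ 6 * (1 - θ)⁻¹ + 2 * cN * γ ^ 6)) * θ ^ (b * (j + 1)) := by
  obtain ⟨KG₀, hKG₀, ε₀, hε₀, hcurved⟩ := curved_grad_letter (d := 3) (n := n) (by norm_num) hL
  have hL0 : (0 : ℝ) < L := by exact_mod_cast (show 0 < L by omega)
  have hL1r : (1 : ℝ) ≤ L := by exact_mod_cast (show 1 ≤ L by omega)
  have hlogL0 : 0 ≤ Real.log (L : ℝ) := Real.log_nonneg hL1r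
  -- the curved C¹ letter's constant absorbs the block-size logarithm: `1 + log M = 1 + (j+1) log L ≤ (1 + log L)(1 + (j+1))`
  set KG : ℝ := KG₀ * (1 + Real.log (L : ℝ)) with hKGdef
  have hKG : 0 < KG := by rw [hKGdef]; positivity
  refine ⟨KG, hKG, ε₀, hε₀, ?_⟩
  intro b hb N _ j ε CSε c cN hε hεε₀ hC0 hC hc hcN W hWu hWP hWx hs X XT XN hXs hXP hXdec hXT α hXα hαM hUx γ hγ hEγ hNs hNc hx₁W hx₁U θ hθ hθ18 κ x μ
  have hN : 1 ≤ N := Nat.one_le_iff_ne_zero.mpr (NeZero.ne N)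
  haveI : NeZero (N * L ^ (j + 1)) := ⟨Nat.mul_ne_zero (NeZero.ne N) (pow_ne_zero _ (by omega))⟩
  -- (0) scales and sizes
  set M : ℝ := (L : ℝ) ^ (j + 1) with hM
  have hM1 : 1 ≤ M := one_le_pow₀ hL1r
  have hM0 : 0 < M := by positivity
  have hθ1 : θ < 1 := theta18_lt_one hL hθ18
  have hθ0 : 0 ≤ θ := hθ.le
  have hξ : θ ^ (18 * (j + 1)) = M⁻¹ := by rw [pow_mul, hθ18, hM, inv_pow]
  set E : ℝ := energyNormW L (j + 1) W X (periodBox (d := 4) (N * L ^ (j + 1))) with hEdef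
  have hE0 : 0 ≤ E := energyNormW_nonneg _ _ _ _ _
  have hE : E ≤ γ ^ 3 * θ ^ (18 * (j + 1)) := by
    rw [hξ, ← div_eq_mul_inv, le_div_iff₀ hM0, mul_comm]; exact hEγ
  have hE2 : E ^ 2 ≤ γ ^ 6 * θ ^ (36 * (j + 1)) := by
    have h := pow_le_pow_left₀ hE0 hE 2
    have e : (γ ^ 3 * θ ^ (18 * (j + 1))) ^ 2 = γ ^ 6 * θ ^ (36 * (j + 1)) := by
      rw [mul_pow, ← pow_mul, ← pow_mul]; ring_nf
    rwa [e] at h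
  have hγ6 : 0 ≤ γ ^ 6 := by positivity
  -- the normal part's letters in the `θ` currency
  have hM1inv : M⁻¹ = θ ^ (18 * (j + 1)) := hξ.symm
  have hNM1 : cN / M * E ^ 2 ≤ cN * γ ^ 6 * θ ^ (54 * (j + 1)) := by
    rw [div_eq_mul_inv, hM1inv]
    have e : cN * γ ^ 6 * θ ^ (54 * (j + 1)) = cN * θ ^ (18 * (j + 1)) * (γ ^ 6 * θ ^ (36 * (j + 1))) := by
      rw [show 54 * (j + 1) = 18 * (j + 1) + 36 * (j + 1) by ring, pow_add]; ring
    rw [e]; exact mul_le_mul_of_nonneg_left hE2 (by positivity)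
  have hNM2 : cN / M ^ 2 * E ^ 2 ≤ cN * γ ^ 6 * θ ^ (72 * (j + 1)) := by
    rw [div_eq_mul_inv, ← inv_pow, hM1inv, ← pow_mul]
    have e : cN * γ ^ 6 * θ ^ (72 * (j + 1)) = cN * θ ^ (18 * (j + 1) * 2) * (γ ^ 6 * θ ^ (36 * (j + 1))) := by
      rw [show 72 * (j + 1) = 18 * (j + 1) * 2 + 36 * (j + 1) by ring, pow_add]; ring
    rw [e]; exact mul_le_mul_of_nonneg_left hE2 (by positivity)
  -- the logarithm: `1 + log M = 1 + (j+1) log L ≤ (1 + log L)(1 + (j+1))`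
  have hlogM : Real.log M = ((j + 1 : ℕ) : ℝ) * Real.log (L : ℝ) := by rw [hM, Real.log_pow]
  have hlog0 : 0 ≤ Real.log M := Real.log_nonneg hM1
  have hlog1 : KG₀ * (1 + Real.log M) ≤ KG * (1 + ((j + 1 : ℕ) : ℝ)) := by
    rw [hKGdef, hlogM, mul_assoc]
    apply mul_le_mul_of_nonneg_left _ hKG₀.le
    have hk : (0 : ℝ) ≤ ((j + 1 : ℕ) : ℝ) := by positivity
    nlinarith [mul_nonneg hk hlogL0]
  -- (1) the maximum `G` of the covariant gradient
  obtain ⟨G, ⟨y₀, κ₀, τ₀, hGeq⟩, hle⟩ := exists_max_covGrad (P := N * L ^ (j + 1)) hWP hXP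
  have hG0 : 0 ≤ G := (norm_nonneg _).trans (hle x κ μ)
  refine (hle x κ μ).trans ?_
  -- (2) the normal part at the maximising bond
  have hXNpt : ∀ y ν, ‖XN y ν‖ ≤ cN / M * E ^ 2 := hNs
  have hvN : ‖Ad (W (y₀ + e κ₀) τ₀) (XN (y₀ + e τ₀) κ₀) - XN y₀ κ₀‖ ≤ 2 * (cN / M * E ^ 2) := by
    refine (norm_sub_le _ _).trans ?_
    rw [norm_Ad_of_unitary (hWu _ _)]
    linarith [hXNpt (y₀ + e τ₀) κ₀, hXNpt y₀ κ₀]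
  -- (3) the split at the maximising bond
  have hsplit : G ≤ ‖Ad (W (y₀ + e κ₀) τ₀) (XT (y₀ + e τ₀) κ₀) - XT y₀ κ₀‖ + 2 * (cN / M * E ^ 2) := by
    rw [hGeq]
    have eX : ∀ y ν, X y ν = XT y ν + XN y ν := fun y ν => by rw [hXdec]; rfl
    rw [eX, eX, Ad_add]
    calc ‖Ad (W (y₀ + e κ₀) τ₀) (XT (y₀ + e τ₀) κ₀) + Ad (W (y₀ + e κ₀) τ₀) (XN (y₀ + e τ₀) κ₀) - (XT y₀ κ₀ + XN y₀ κ₀)‖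
        = ‖(Ad (W (y₀ + e κ₀) τ₀) (XT (y₀ + e τ₀) κ₀) - XT y₀ κ₀) + (Ad (W (y₀ + e κ₀) τ₀) (XN (y₀ + e τ₀) κ₀) - XN y₀ κ₀)‖ := by
          congr 1; abel
      _ ≤ _ := (norm_add_le _ _).trans (add_le_add le_rfl hvN)
  -- (4) the curl of the slice part from a curl bound of `X`
  have hcurlT : ∀ {BX : ℝ}, (∀ (z : Site 4) (μ' ν' : Fin 4), μ' ≠ ν' → ‖curlAt W X z μ' ν'‖ ≤ BX) →
      ∀ (z : Site 4) (μ' ν' : Fin 4), μ' ≠ ν' → ‖curlAt W XT z μ' ν'‖ ≤ BX + cN / M ^ 2 * E ^ 2 := by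
    intro BX hBX z μ' ν' hne
    have e : curlAt W XT z μ' ν' = curlAt W X z μ' ν' - curlAt W XN z μ' ν' := by
      rw [hXdec, curlAt_add]; abel
    rw [e]
    exact (norm_sub_le _ _).trans (add_le_add (hBX z μ' ν' hne) (hNc z μ' ν' hne))
  -- (5) the curved C¹ letter of the slice part, for a curl bound `BX > 0` of `X`
  have hT : (tower L N (j + 1) : ℕ) = N * L ^ (j + 1) := by rw [tower_eq_pow_mul, Nat.mul_comm]
  have hWPt : IsPeriodicCfg W ((tower L N (j + 1) : ℕ) : ℤ) := by rw [hT]; exact hWP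
  have hx0 : 0 ≤ ε / M ^ 2 := by positivity
  have hεM : ((L : ℝ) ^ (j + 1)) ^ 2 * (ε / M ^ 2) ≤ ε₀ := by
    rw [← hM, mul_div_cancel₀ _ (by positivity)]; exact hεε₀
  have hstep : ∀ {BX : ℝ}, 0 < BX → (∀ (z : Site 4) (μ' ν' : Fin 4), μ' ≠ ν' → ‖curlAt W X z μ' ν'‖ ≤ BX) →
      G ≤ KG * (1 + ((j + 1 : ℕ) : ℝ)) * BX + (KG * (1 + ((j + 1 : ℕ) : ℝ)) * (cN / M ^ 2 * E ^ 2) + 2 * (cN / M * E ^ 2)) := by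
    intro BX hBX hcX
    have hB0 : 0 < BX + cN / M ^ 2 * E ^ 2 := by positivity
    have hcT := hcurlT hcX
    have h : ‖Ad (W (y₀ + e κ₀) τ₀) (XT (y₀ + e τ₀) κ₀) - XT y₀ κ₀‖ ≤ KG₀ * (1 + Real.log M) * (BX + cN / M ^ 2 * E ^ 2) :=
      hcurved j N W (ε / M ^ 2) hWu hWPt hx0 hs hWx hεM XT hXT (BX + cN / M ^ 2 * E ^ 2) hB0 hcT y₀ τ₀ κ₀
    have hmono : KG₀ * (1 + Real.log M) * (BX + cN / M ^ 2 * E ^ 2) ≤ KG * (1 + ((j + 1 : ℕ) : ℝ)) * (BX + cN / M ^ 2 * E ^ 2) :=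
      mul_le_mul_of_nonneg_right hlog1 hB0.le
    have h2 := hsplit.trans (add_le_add (h.trans hmono) le_rfl)
    have e : KG * (1 + ((j + 1 : ℕ) : ℝ)) * (BX + cN / M ^ 2 * E ^ 2) + 2 * (cN / M * E ^ 2)
        = KG * (1 + ((j + 1 : ℕ) : ℝ)) * BX + (KG * (1 + ((j + 1 : ℕ) : ℝ)) * (cN / M ^ 2 * E ^ 2) + 2 * (cN / M * E ^ 2)) := by ring
    rw [← e]; exact h2
  -- (6) the curl bound of `X` for an admissible cube `l₂`
  set Λ0 : ℝ := 10 * c + 6 * curConst 4 L * ε ^ 2 + 8 * CSε * ε + 4096 * CSε ^ 2 * ε + 1330 * CSε ^ 3 with hΛ0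
  have hΛ00 : 0 ≤ Λ0 := by rw [hΛ0]; have := curConst_nonneg (d := 4) L; positivity
  have hcurlX : ∀ {l₂ : ℝ}, 0 < l₂ → γ ≤ l₂ → Λ0 + 128 * CSε * M ^ 2 * G ≤ l₂ ^ 3 →
      ∀ (z : Site 4) (μ' ν' : Fin 4), μ' ≠ ν' → ‖curlAt W X z μ' ν'‖ ≤ 8 * l₂ ^ 2 * γ * θ ^ (42 * (j + 1)) := by
    intro l₂ hl₂ hγl hΛ z μ' ν' hne
    exact curl_sup_rate hL hN j hε hC0 hC hWu hWP hWx hXs hXP hXα hαM hUx hγ hEγ hx₁W hx₁U hle hl₂ hγl (by rw [← hM]; exact hΛ) hθ hθ18 z hne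
  -- (7) THE CASE ANALYSIS on `cG ≤ l₀³`
  set l₀ : ℝ := max γ (max 1 Λ0) with hl₀
  have hl₀γ : γ ≤ l₀ := le_max_left _ _
  have hl₀1 : 1 ≤ l₀ := (le_max_left _ _).trans (le_max_right _ _)
  have hl₀0 : 0 < l₀ := by linarith
  have hl₀Λ : Λ0 ≤ l₀ ^ 3 := by
    have h1 : Λ0 ≤ l₀ := (le_max_right _ _).trans (le_max_right _ _)
    have h2 : l₀ ≤ l₀ ^ 3 := by
      have h3 : 1 ≤ l₀ ^ 2 := one_le_pow₀ hl₀1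
      calc l₀ = l₀ * 1 := (mul_one _).symm
        _ ≤ l₀ * l₀ ^ 2 := mul_le_mul_of_nonneg_left h3 hl₀0.le
        _ = l₀ ^ 3 := by ring
    exact h1.trans h2
  set cc : ℝ := 128 * CSε * M ^ 2 with hcc
  have hcc0 : 0 ≤ cc := by positivity
  set D : ℝ := (1 - θ)⁻¹ with hD
  have hD0 : 0 ≤ D := inv_nonneg.mpr (by linarith)
  set R' : ℝ := KG * (1 + ((j + 1 : ℕ) : ℝ)) * (cN / M ^ 2 * E ^ 2) + 2 * (cN / M * E ^ 2) with hR'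
  have hR'0 : 0 ≤ R' := by positivity
  -- the normal part's rate: `R' ≤ (K_G c_N γ⁶ D + 2 c_N γ⁶) θ^{38k}`
  have hR'le : R' ≤ (KG * cN * γ ^ 6 * D + 2 * cN * γ ^ 6) * θ ^ (b * (j + 1)) := by
    have h1 : KG * (1 + ((j + 1 : ℕ) : ℝ)) * (cN / M ^ 2 * E ^ 2) ≤ KG * (1 + ((j + 1 : ℕ) : ℝ)) * (cN * γ ^ 6 * θ ^ (72 * (j + 1))) :=
      mul_le_mul_of_nonneg_left hNM2 (by positivity)
    have h2 : 2 * (cN / M * E ^ 2) ≤ 2 * (cN * γ ^ 6 * θ ^ (54 * (j + 1))) := by linarith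
    have h3 := rate_normal_le (A := KG * cN * γ ^ 6) (B := 2 * cN * γ ^ 6) hθ0 hθ1 (by positivity) (by positivity) (show b ≤ 54 by omega) (j + 1)
    calc R' ≤ KG * (1 + ((j + 1 : ℕ) : ℝ)) * (cN * γ ^ 6 * θ ^ (72 * (j + 1))) + 2 * (cN * γ ^ 6 * θ ^ (54 * (j + 1))) := add_le_add h1 h2
      _ = KG * cN * γ ^ 6 * (1 + ((j + 1 : ℕ) : ℝ)) * θ ^ (72 * (j + 1)) + 2 * cN * γ ^ 6 * θ ^ (54 * (j + 1)) := by ring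
      _ ≤ (KG * cN * γ ^ 6 * (1 - θ)⁻¹ + 2 * cN * γ ^ 6) * θ ^ (b * (j + 1)) := h3
  have hθ38 : 0 ≤ θ ^ (b * (j + 1)) := pow_nonneg hθ0 _
  -- the three constants of the bound are non-negative
  have hA0 : 0 ≤ 32 * KG * l₀ ^ 2 * γ * D := by positivity
  have hB0 : 0 ≤ 2 ^ 27 * CSε ^ 2 * KG ^ 3 * γ ^ 3 * D ^ 3 := by positivity
  have hC0' : 0 ≤ 2 * (KG * cN * γ ^ 6 * D + 2 * cN * γ ^ 6) := by positivity
  rcases le_or_gt (cc * G) (l₀ ^ 3) with hA | hB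
  · -- CASE A: `l₂ := 2l₀`
    have hl₂ : 0 < 2 * l₀ := by positivity
    have hΛ : Λ0 + 128 * CSε * M ^ 2 * G ≤ (2 * l₀) ^ 3 := by
      have : 0 ≤ l₀ ^ 3 := by positivity
      have e8 : (2 * l₀) ^ 3 = 8 * l₀ ^ 3 := by ring
      rw [← hcc, e8]; linarith
    have hcX := hcurlX hl₂ (by linarith) hΛ
    have hBX : 0 < 8 * (2 * l₀) ^ 2 * γ * θ ^ (42 * (j + 1)) :=
      mul_pos (mul_pos (mul_pos (by norm_num) (pow_pos (by linarith) 2)) hγ) (pow_pos hθ _)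
    have h1 := hstep hBX hcX
    have h2 : KG * (1 + ((j + 1 : ℕ) : ℝ)) * (8 * (2 * l₀) ^ 2 * γ * θ ^ (42 * (j + 1)))
        = (32 * KG * l₀ ^ 2 * γ) * (1 + ((j + 1 : ℕ) : ℝ)) * θ ^ (42 * (j + 1)) := by ring
    have h3 := rate_caseA_le (A := 32 * KG * l₀ ^ 2 * γ) hθ0 hθ1 (by positivity) hb (j + 1)
    rw [h2] at h1
    have h4 : G ≤ 32 * KG * l₀ ^ 2 * γ * D * θ ^ (b * (j + 1)) + (KG * cN * γ ^ 6 * D + 2 * cN * γ ^ 6) * θ ^ (b * (j + 1)) := by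
      linarith
    have p1 : 0 ≤ 2 ^ 27 * CSε ^ 2 * KG ^ 3 * γ ^ 3 * D ^ 3 * θ ^ (b * (j + 1)) := mul_nonneg hB0 hθ38
    have p2 : 0 ≤ (KG * cN * γ ^ 6 * D + 2 * cN * γ ^ 6) * θ ^ (b * (j + 1)) := mul_nonneg (by positivity) hθ38
    have e : (32 * KG * l₀ ^ 2 * γ * D + 2 ^ 27 * CSε ^ 2 * KG ^ 3 * γ ^ 3 * D ^ 3 + 2 * (KG * cN * γ ^ 6 * D + 2 * cN * γ ^ 6)) * θ ^ (b * (j + 1))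
        = 32 * KG * l₀ ^ 2 * γ * D * θ ^ (b * (j + 1)) + 2 ^ 27 * CSε ^ 2 * KG ^ 3 * γ ^ 3 * D ^ 3 * θ ^ (b * (j + 1))
          + 2 * ((KG * cN * γ ^ 6 * D + 2 * cN * γ ^ 6) * θ ^ (b * (j + 1))) := by ring
    rw [e]; linarith
  · -- CASE B: `l₂³ := 2cG`
    have hccG : 0 < cc * G := lt_of_le_of_lt (by positivity) hB
    have hcc1 : 0 < cc := by
      rcases hcc0.eq_or_lt with h | h
      · rw [← h, zero_mul] at hccG; exact absurd hccG (lt_irrefl 0)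
      · exact h
    obtain ⟨l₂, hl₂, hl₂3⟩ := exists_cube_root (show 0 < 2 * cc * G by linarith [hccG])
    have hl₀l₂ : l₀ ≤ l₂ := by
      by_contra hlt
      have hlt' : l₂ < l₀ := lt_of_not_ge hlt
      have h3 : l₂ ^ 3 < l₀ ^ 3 := pow_lt_pow_left₀ hlt' hl₂.le (by norm_num)
      have h4 : 0 ≤ cc * G := hccG.le
      linarith
    have hΛ : Λ0 + 128 * CSε * M ^ 2 * G ≤ l₂ ^ 3 := by rw [← hcc, hl₂3]; linarith [hB.le]
    have hcX := hcurlX hl₂ (hl₀γ.trans hl₀l₂) hΛ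
    have hBX : 0 < 8 * l₂ ^ 2 * γ * θ ^ (42 * (j + 1)) := mul_pos (mul_pos (mul_pos (by norm_num) (pow_pos hl₂ 2)) hγ) (pow_pos hθ _)
    have h1 := hstep hBX hcX
    -- `G ≤ K′ l₂² + R′`
    set K' : ℝ := KG * (1 + ((j + 1 : ℕ) : ℝ)) * (8 * γ * θ ^ (42 * (j + 1))) with hK'
    have hK'0 : 0 ≤ K' := by positivity
    have h1' : G ≤ K' * l₂ ^ 2 + R' := by
      have e : KG * (1 + ((j + 1 : ℕ) : ℝ)) * (8 * l₂ ^ 2 * γ * θ ^ (42 * (j + 1))) = K' * l₂ ^ 2 := by rw [hK']; ring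
      linarith
    have h2 := caseB_bound hcc1 hK'0 hR'0 hl₂ (by rw [hl₂3]) h1'
    -- `16 cc² K′³ = 2²⁷ C_Sε² K_G³ γ³ (1+k)³ θ^{54k}` (using `M⁴ θ^{72k} = 1`)
    have hM4 : M ^ 4 * θ ^ (72 * (j + 1)) = 1 := by
      rw [show 72 * (j + 1) = 18 * (j + 1) * 4 by ring, pow_mul, hξ, ← mul_pow, mul_inv_cancel₀ hM0.ne', one_pow]
    have h3 : 16 * cc ^ 2 * K' ^ 3 = 2 ^ 27 * CSε ^ 2 * KG ^ 3 * γ ^ 3 * (1 + ((j + 1 : ℕ) : ℝ)) ^ 3 * θ ^ (54 * (j + 1)) := by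
      have e : (θ ^ (42 * (j + 1))) ^ 3 = θ ^ (72 * (j + 1)) * θ ^ (54 * (j + 1)) := by
        rw [← pow_mul, ← pow_add]; congr 1; ring
      rw [hcc, hK']
      calc 16 * (128 * CSε * M ^ 2) ^ 2 * (KG * (1 + ((j + 1 : ℕ) : ℝ)) * (8 * γ * θ ^ (42 * (j + 1)))) ^ 3
          = 2 ^ 27 * CSε ^ 2 * KG ^ 3 * γ ^ 3 * (1 + ((j + 1 : ℕ) : ℝ)) ^ 3 * (M ^ 4 * (θ ^ (42 * (j + 1))) ^ 3) := by ring
        _ = 2 ^ 27 * CSε ^ 2 * KG ^ 3 * γ ^ 3 * (1 + ((j + 1 : ℕ) : ℝ)) ^ 3 * θ ^ (54 * (j + 1)) := by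
          rw [e, ← mul_assoc (M ^ 4), hM4, one_mul]
    have h4 := rate_caseB_le (A := 2 ^ 27 * CSε ^ 2 * KG ^ 3 * γ ^ 3) hθ0 hθ1 (by positivity) (show b ≤ 51 by omega) (j + 1)
    rw [h3] at h2
    have h5 : G ≤ 2 ^ 27 * CSε ^ 2 * KG ^ 3 * γ ^ 3 * D ^ 3 * θ ^ (b * (j + 1))
        + 2 * ((KG * cN * γ ^ 6 * D + 2 * cN * γ ^ 6) * θ ^ (b * (j + 1))) := by
      linarith
    have p1 : 0 ≤ 32 * KG * l₀ ^ 2 * γ * D * θ ^ (b * (j + 1)) := mul_nonneg hA0 hθ38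
    have e : (32 * KG * l₀ ^ 2 * γ * D + 2 ^ 27 * CSε ^ 2 * KG ^ 3 * γ ^ 3 * D ^ 3 + 2 * (KG * cN * γ ^ 6 * D + 2 * cN * γ ^ 6)) * θ ^ (b * (j + 1))
        = 32 * KG * l₀ ^ 2 * γ * D * θ ^ (b * (j + 1)) + 2 ^ 27 * CSε ^ 2 * KG ^ 3 * γ ^ 3 * D ^ 3 * θ ^ (b * (j + 1))
          + 2 * ((KG * cN * γ ^ 6 * D + 2 * cN * γ ^ 6) * θ ^ (b * (j + 1))) := by ring
    rw [e]; linarith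

end

end Summit.QuantumFields.BalabanUV.T4Continuum.NE7PairCovGradRate40Generic
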